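import Mathlib
import Summits.RiemannHypothesis.RiemannHypothesis.Theorems.WeilFormatCOffDiagHSBound
import HarnessLib

/-!
# Format C: the odd-sector polar off-diagonal part `−(32s²/a)·d dᵀ` on the far modes costs at most `2s²a/(π²M₁)`

Route context: Fourier–Galerkin / Schur-complement certificates of Weil positivity on a window ("format C";
cell memo `run/shared/lean/pub/rh-explicit/rh-explicit-weil-10/FORMATC-DESIGN.md` §4.3, POLAR_off odd; supporting
stmt-RiemannHypothesis-0098).  In the odd sector the polar part of the far Gram is the negative rank-one matrix
`−(32s²/a) d dᵀ`, `d_n = ω_n/(1 + 4ω_n²)`, `ω_n = πn/a`.  Since `d_n ≤ 1/(4ω_n) = a/(4πn)` and `Σ_{n>M₁} n⁻² ≤ 1/M₁`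
(`WeilFormatC.sum_Ioc_inv_sq_le`), its quadratic form is bounded by `(32s²/a)·(a²/(16π²M₁))·‖y‖² = (2s²a/(π²M₁))‖y‖²`
— the `ϖ` of `WeilFormatC.farBlock_ge_diag`.  THIS FILE proves, for finite truncations `M₁ < n ≤ N`:

* `WeilFormatC.sq_dotProduct_le` — rank one: `(Σ_n d_n y_n)² ≤ (Σ_n d_n²)(Σ_n y_n²)`;
* `WeilFormatC.polarWeight_sq_le` — `(ω/(1+4ω²))² ≤ 1/(16ω²)` for `ω ≠ 0`;
* `WeilFormatC.sum_polarWeight_sq_le` — `Σ_{n=M₁+1}^{N} (ω_n/(1+4ω_n²))² ≤ a²/(16π²M₁)` (`0 < a`, `1 ≤ M₁`);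
* `WeilFormatC.oddPolar_quadForm_ge` — **`−(2s²a/(π²M₁))·Σ y_n² ≤ −(32s²/a)·(Σ_n d_n y_n)²`** for `s² ≥ 0`.

Elementary; standard axioms only.
-/

-- `Summit.RiemannHypothesis.RiemannHypothesis.…` is the layout-mandated namespace (summit = problem name).
set_option linter.dupNamespace false

noncomputable section

namespace Summit.RiemannHypothesis.RiemannHypothesis.Theorems.WeilFormatC

open Finset Real

/-- Cauchy–Schwarz for the rank-one polar direction. -/
theorem sq_dotProduct_le (s : Finset ℕ) (d y : ℕ → ℝ) :
    (∑ n ∈ s, d n * y n) ^ 2 ≤ (∑ n ∈ s, d n ^ 2) * (∑ n ∈ s, y n ^ 2) :=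
  Finset.sum_mul_sq_le_sq_mul_sq s d y

/-- `(ω/(1+4ω²))² ≤ 1/(16ω²)` for `ω ≠ 0` (since `(1+4ω²)² ≥ 16ω⁴`). -/
theorem polarWeight_sq_le {ω : ℝ} (hω : ω ≠ 0) : (ω / (1 + 4 * ω ^ 2)) ^ 2 ≤ 1 / (16 * ω ^ 2) := by
  have hω2 : 0 < ω ^ 2 := by positivity
  have hden : 0 < 1 + 4 * ω ^ 2 := by positivity
  rw [div_pow, div_le_div_iff₀ (by positivity) (by positivity)]
  nlinarith [sq_nonneg (ω ^ 2), hω2]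

/-- `Σ_{n=M₁+1}^{N} (ω_n/(1+4ω_n²))² ≤ a²/(16π²M₁)` with `ω_n = πn/a`, `0 < a`, `1 ≤ M₁`. -/
theorem sum_polarWeight_sq_le {a : ℝ} (ha : 0 < a) {M₁ N : ℕ} (hM : 1 ≤ M₁) :
    ∑ n ∈ Finset.Ioc M₁ N, (π * n / a / (1 + 4 * (π * n / a) ^ 2)) ^ 2 ≤ a ^ 2 / (16 * π ^ 2 * M₁) := by
  have hterm : ∀ n ∈ Finset.Ioc M₁ N,
      (π * n / a / (1 + 4 * (π * n / a) ^ 2)) ^ 2 ≤ a ^ 2 / (16 * π ^ 2) * (1 / (n : ℝ) ^ 2) := by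
    intro n hn
    have hn : (0 : ℝ) < n := by
      have := (Finset.mem_Ioc.mp hn).1; exact_mod_cast (by omega : 0 < n)
    have hω : π * n / a ≠ 0 := by positivity
    refine (polarWeight_sq_le hω).trans (le_of_eq ?_)
    field_simp
  refine (Finset.sum_le_sum hterm).trans ?_
  rw [← Finset.mul_sum]
  have h := sum_Ioc_inv_sq_le (N := N) hM
  have hc : 0 ≤ a ^ 2 / (16 * π ^ 2) := by positivity
  calc a ^ 2 / (16 * π ^ 2) * ∑ n ∈ Finset.Ioc M₁ N, 1 / (n : ℝ) ^ 2
      ≤ a ^ 2 / (16 * π ^ 2) * (1 / (M₁ : ℝ)) := mul_le_mul_of_nonneg_left h hc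
    _ = a ^ 2 / (16 * π ^ 2 * M₁) := by
        have : (0 : ℝ) < M₁ := by exact_mod_cast hM
        field_simp

/-- **The odd polar part costs at most `2s²a/(π²M₁)`.**  For `0 < a`, `1 ≤ M₁`, `0 ≤ s2` (= `s²`) and every real `y`
on the modes `M₁ < n ≤ N`:
`−(2·s2·a/(π²M₁))·Σ y_n² ≤ −(32·s2/a)·(Σ_n d_n y_n)²`, `d_n = ω_n/(1+4ω_n²)`. -/
theorem oddPolar_quadForm_ge {a s2 : ℝ} (ha : 0 < a) (hs : 0 ≤ s2) {M₁ N : ℕ} (hM : 1 ≤ M₁) (y : ℕ → ℝ) :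
    -(2 * s2 * a / (π ^ 2 * M₁)) * ∑ n ∈ Finset.Ioc M₁ N, y n ^ 2
      ≤ -(32 * s2 / a) * (∑ n ∈ Finset.Ioc M₁ N, (π * n / a / (1 + 4 * (π * n / a) ^ 2)) * y n) ^ 2 := by
  set s := Finset.Ioc M₁ N
  have hcs := sq_dotProduct_le s (fun n ↦ π * n / a / (1 + 4 * (π * n / a) ^ 2)) y
  have hw := sum_polarWeight_sq_le (N := N) ha hM
  have hy : 0 ≤ ∑ n ∈ s, y n ^ 2 := Finset.sum_nonneg fun n _ ↦ sq_nonneg _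
  have h1 : (∑ n ∈ s, (π * n / a / (1 + 4 * (π * n / a) ^ 2)) * y n) ^ 2
      ≤ a ^ 2 / (16 * π ^ 2 * M₁) * ∑ n ∈ s, y n ^ 2 :=
    hcs.trans (mul_le_mul_of_nonneg_right hw hy)
  have hc : 0 ≤ 32 * s2 / a := by positivity
  have h2 := mul_le_mul_of_nonneg_left h1 hc
  have e : 32 * s2 / a * (a ^ 2 / (16 * π ^ 2 * M₁) * ∑ n ∈ s, y n ^ 2)
      = 2 * s2 * a / (π ^ 2 * M₁) * ∑ n ∈ s, y n ^ 2 := by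
    have hM0 : (0 : ℝ) < M₁ := by exact_mod_cast hM
    field_simp
    ring
  rw [e] at h2
  linarith

end Summit.RiemannHypothesis.RiemannHypothesis.Theorems.WeilFormatC
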